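import Literature.AlgebraicGeometry.Motives.MixedHodgeStructureSimple
import HarnessLib

/-!
# The socle of a mixed Hodge structure: the largest semisimple sub-MHS

In the abelian category of mixed Hodge structures (Cattani–El Zein–Griffiths–Lê, *Hodge Theory*, Thm. 3.2.18;
"simple := no nontrivial subobject; semisimple := direct sum of simples", p. 270) every object on a
finite-dimensional space has a largest semisimple sub-object, the sum of its simple sub-objects — its **socle**.
We construct it for the tree's `MixedHodgeStructure.IsSemisimple` / `IsSimple` (files `MixedHodgeStructureSemisimple`,
`MixedHodgeStructureSemisimpleSums`, `MixedHodgeStructureSimple`) as a semisimple sub-MHS of maximal dimension and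
prove (namespace `MixedHodgeStructure`; everything proved, no named facts):

* `socle H` (a `SubMixedHodgeStructure H`), `isSemisimple_socle`;
* **`le_socle`**: every semisimple (in particular every simple) sub-MHS lies in the socle, and `socle` is the only
  semisimple sub-MHS with this property (`eq_socle`);
* **`socle_toSubmodule_eq_iSup`**: the socle is the sum of all simple sub-MHS;
* **`socle_eq_top_iff`**: `H` is semisimple iff its socle is everything; `socle_ne_bot` for `V ≠ 0`;
* functoriality **`map_socle_le`**: morphisms map socles into socles.

## References

* [CattaniElZeinGriffithsLe2014] E. Cattani et al. (eds.), Hodge Theory (2014), Thm. 3.2.18, Lemma 3.2.20, p. 270.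
* [Jannsen1990MixedMotives] U. Jannsen, Mixed Motives and Algebraic K-Theory, LNM 1400 (1990), 7.8 b).
-/

noncomputable section

open scoped TensorProduct

namespace Literature.AlgebraicGeometry.Motives

namespace MixedHodgeStructure

universe u v

variable {V : Type u} [AddCommGroup V] [Module ℚ V]
variable {V' : Type v} [AddCommGroup V'] [Module ℚ V']

section Socle

variable (H : MixedHodgeStructure V)

/-- There is a semisimple sub-MHS of codimension `k` for the least possible `k` (codimension `dim V` is realised by
`0`). [cite: CattaniElZeinGriffithsLe2014, Thm. 3.2.18] -/
private theorem exists_codim : ∃ k : ℕ, ∃ S : SubMixedHodgeStructure H,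
    S.toMixedHodgeStructure.IsSemisimple ∧ Module.finrank ℚ S.toSubmodule + k = Module.finrank ℚ V :=
  ⟨Module.finrank ℚ V, SubMixedHodgeStructure.bot H, by
    haveI : Subsingleton ↥(SubMixedHodgeStructure.bot H).toSubmodule := by
      change Subsingleton ↥(⊥ : Submodule ℚ V); infer_instance
    exact isSemisimple_of_subsingleton _, by
    rw [SubMixedHodgeStructure.bot_toSubmodule, finrank_bot, zero_add]⟩

open scoped Classical in
/-- **The socle of `H`**: a semisimple sub-MHS of maximal dimension (below: the largest semisimple sub-MHS, the sum
of all simple sub-MHS). [cite: CattaniElZeinGriffithsLe2014, Thm. 3.2.18 and p. 270] -/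
def socle : SubMixedHodgeStructure H :=
  Classical.choose (Nat.find_spec (exists_codim H))

open scoped Classical in
/-- The defining property of the chosen socle. [cite: CattaniElZeinGriffithsLe2014, Thm. 3.2.18] -/
private theorem socle_spec : (socle H).toMixedHodgeStructure.IsSemisimple ∧
    Module.finrank ℚ (socle H).toSubmodule + Nat.find (exists_codim H) = Module.finrank ℚ V :=
  Classical.choose_spec (Nat.find_spec (exists_codim H))

/-- **The socle is semisimple.** [cite: CattaniElZeinGriffithsLe2014, Thm. 3.2.18 and p. 270] -/
theorem isSemisimple_socle : (socle H).toMixedHodgeStructure.IsSemisimple :=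
  (socle_spec H).1

open scoped Classical in
/-- Maximality of the dimension of the socle among semisimple sub-MHS. [cite: CattaniElZeinGriffithsLe2014, Thm. 3.2.18] -/
theorem finrank_le_finrank_socle [FiniteDimensional ℚ V] (S : SubMixedHodgeStructure H) (hS : S.toMixedHodgeStructure.IsSemisimple) :
    Module.finrank ℚ S.toSubmodule ≤ Module.finrank ℚ (socle H).toSubmodule := by
  have hsoc := (socle_spec H).2
  have hSle : Module.finrank ℚ S.toSubmodule ≤ Module.finrank ℚ V := Submodule.finrank_le _
  have hmin := Nat.find_min' (exists_codim H) ⟨S, hS, Nat.add_sub_of_le hSle⟩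
  omega

variable {H}

/-- **Every semisimple sub-MHS lies in the socle** (`S + socle` is semisimple of dimension `≥ dim socle`).
[cite: CattaniElZeinGriffithsLe2014, Thm. 3.2.18 and p. 270] -/
theorem le_socle [FiniteDimensional ℚ V] (S : SubMixedHodgeStructure H) (hS : S.toMixedHodgeStructure.IsSemisimple) :
    S.toSubmodule ≤ (socle H).toSubmodule := by
  have hsup : (S.sup (socle H)).toMixedHodgeStructure.IsSemisimple := hS.sup (isSemisimple_socle H)
  have hle : (socle H).toSubmodule ≤ (S.sup (socle H)).toSubmodule := by
    rw [SubMixedHodgeStructure.sup_toSubmodule]; exact le_sup_right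
  have heq : (socle H).toSubmodule = (S.sup (socle H)).toSubmodule :=
    Submodule.eq_of_le_of_finrank_le hle (finrank_le_finrank_socle H _ hsup)
  rw [heq, SubMixedHodgeStructure.sup_toSubmodule]
  exact le_sup_left

/-- Every simple sub-MHS lies in the socle. [cite: CattaniElZeinGriffithsLe2014, p. 270] -/
theorem le_socle_of_isSimple [FiniteDimensional ℚ V] (S : SubMixedHodgeStructure H) (hS : S.toMixedHodgeStructure.IsSimple) :
    S.toSubmodule ≤ (socle H).toSubmodule :=
  le_socle S hS.isSemisimple

/-- **Characterisation**: the socle is the unique semisimple sub-MHS containing all semisimple sub-MHS.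
[cite: CattaniElZeinGriffithsLe2014, Thm. 3.2.18 and p. 270] -/
theorem eq_socle [FiniteDimensional ℚ V] (M : SubMixedHodgeStructure H) (hM : M.toMixedHodgeStructure.IsSemisimple)
    (hmax : ∀ S : SubMixedHodgeStructure H, S.toMixedHodgeStructure.IsSemisimple → S.toSubmodule ≤ M.toSubmodule) :
    M = socle H :=
  SubMixedHodgeStructure.ext (le_antisymm (le_socle M hM) (hmax _ (isSemisimple_socle H)))

/-- **The socle is the sum of all simple sub-MHS.** [cite: CattaniElZeinGriffithsLe2014, p. 270] -/
theorem socle_toSubmodule_eq_iSup [FiniteDimensional ℚ V] :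
    (socle H).toSubmodule = ⨆ S : {S : SubMixedHodgeStructure H // S.toMixedHodgeStructure.IsSimple}, S.1.toSubmodule := by
  refine le_antisymm ?_ (iSup_le fun S => le_socle_of_isSimple S.1 S.2)
  -- the socle is a finite sum of simple sub-MHS of itself, which are simple sub-MHS of `H`
  obtain ⟨s, hs, htop⟩ := (isSemisimple_socle H).exists_finset_isSimple
  have h : (socle H).toSubmodule = (⨆ R ∈ s, R.toSubmodule).map (socle H).toSubmodule.subtype := by
    rw [htop, Submodule.map_top, Submodule.range_subtype]
  rw [h, Submodule.map_iSup]
  refine iSup_le fun R => ?_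
  rw [Submodule.map_iSup]
  refine iSup_le fun hR => ?_
  obtain ⟨f, hf⟩ := (socle H).exists_hom_ofSub_bijective R
  exact le_iSup (fun S : {S : SubMixedHodgeStructure H // S.toMixedHodgeStructure.IsSimple} => S.1.toSubmodule)
    ⟨(socle H).ofSub R, (hs R hR).of_bijective f hf⟩

/-- **`H` is semisimple iff its socle is everything.** [cite: CattaniElZeinGriffithsLe2014, Thm. 3.2.18 and p. 270] -/
theorem socle_eq_top_iff [FiniteDimensional ℚ V] : (socle H).toSubmodule = ⊤ ↔ H.IsSemisimple := by
  constructor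
  · intro h
    exact (isSemisimple_socle H).of_bijective (socle H).subtype
      ⟨Subtype.val_injective, fun x => ⟨⟨x, h ▸ Submodule.mem_top⟩, rfl⟩⟩
  · intro h
    exact eq_top_iff.2 (le_socle (SubMixedHodgeStructure.top H)
      (h.of_bijective' (SubMixedHodgeStructure.top H).subtype ⟨Subtype.val_injective, fun x => ⟨⟨x, Submodule.mem_top⟩, rfl⟩⟩))

/-- The socle of a semisimple MHS is everything. [cite: CattaniElZeinGriffithsLe2014, p. 270] -/
theorem IsSemisimple.socle_eq_top [FiniteDimensional ℚ V] (h : H.IsSemisimple) : socle H = SubMixedHodgeStructure.top H :=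
  SubMixedHodgeStructure.ext ((socle_eq_top_iff.2 h).trans (SubMixedHodgeStructure.top_toSubmodule H).symm)

/-- **A non-zero MHS has a non-zero socle** (it has a simple sub-MHS). [cite: CattaniElZeinGriffithsLe2014, p. 270] -/
theorem socle_ne_bot [FiniteDimensional ℚ V] [Nontrivial V] : (socle H).toSubmodule ≠ ⊥ := by
  obtain ⟨S, hS⟩ := H.exists_subMixedHodgeStructure_isSimple
  haveI := hS.nontrivial
  intro h
  have hle := le_socle_of_isSimple S hS
  rw [h, le_bot_iff] at hle
  exact (Submodule.nontrivial_iff_ne_bot.1 inferInstance) hle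

/-- The socle is split over `ℚ` and its simple constituents are pure (a sum of simple, hence pure, sub-MHS).
[cite: CattaniElZeinGriffithsLe2014, Ch. 12 footnote 2 (p. 527)] -/
theorem isSplitOverQ_socle : (socle H).toMixedHodgeStructure.IsSplitOverQ :=
  (isSemisimple_socle H).isSplitOverQ

/-- **Morphisms map socles into socles** (the image of the semisimple `socle H` is a semisimple sub-MHS of `H'`).
[cite: CattaniElZeinGriffithsLe2014, Thm. 3.2.18] -/
theorem map_socle_le [FiniteDimensional ℚ V] [FiniteDimensional ℚ V'] {H : MixedHodgeStructure V} {H' : MixedHodgeStructure V'} (f : Hom H H') :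
    (socle H).toSubmodule.map f.toLinearMap ≤ (socle H').toSubmodule := by
  have hss : (f.comp (socle H).subtype).range.toMixedHodgeStructure.IsSemisimple := (isSemisimple_socle H).range _
  have hle := le_socle _ hss
  rw [Hom.range_toSubmodule, Hom.comp_toLinearMap, LinearMap.range_comp] at hle
  rwa [show LinearMap.range (socle H).subtype.toLinearMap = (socle H).toSubmodule from Submodule.range_subtype _] at hle

/-- Elementwise form: `f` maps socle vectors to socle vectors. [cite: CattaniElZeinGriffithsLe2014, Thm. 3.2.18] -/
theorem Hom.apply_mem_socle [FiniteDimensional ℚ V] [FiniteDimensional ℚ V'] {H : MixedHodgeStructure V} {H' : MixedHodgeStructure V'} (f : Hom H H') {x : V}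
    (hx : x ∈ (socle H).toSubmodule) : f.toLinearMap x ∈ (socle H').toSubmodule :=
  map_socle_le f ⟨x, hx, rfl⟩

/-- An isomorphism maps the socle onto the socle. [cite: CattaniElZeinGriffithsLe2014, Thm. 3.2.18] -/
theorem map_socle_eq_of_bijective [FiniteDimensional ℚ V] [FiniteDimensional ℚ V'] {H : MixedHodgeStructure V} {H' : MixedHodgeStructure V'} (f : Hom H H')
    (hf : Function.Bijective f.toLinearMap) : (socle H).toSubmodule.map f.toLinearMap = (socle H').toSubmodule := by
  refine le_antisymm (map_socle_le f) fun y hy => ?_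
  refine ⟨(f.inverse hf).toLinearMap y, (f.inverse hf).apply_mem_socle hy, ?_⟩
  rw [← LinearMap.comp_apply, ← Hom.comp_toLinearMap, Hom.comp_inverse, Hom.id_toLinearMap, LinearMap.id_apply]

/-- Sub-MHS of the socle are semisimple. [cite: CattaniElZeinGriffithsLe2014, Thm. 3.2.18] -/
theorem isSemisimple_of_le_socle (S : SubMixedHodgeStructure H) (hS : S.toSubmodule ≤ (socle H).toSubmodule) :
    S.toMixedHodgeStructure.IsSemisimple :=
  ((isSemisimple_socle H).subMixedHodgeStructure (SubMixedHodgeStructure.inclusion hS).range).of_bijective'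
    (SubMixedHodgeStructure.inclusion hS).rangeRestrict
    ((SubMixedHodgeStructure.inclusion hS).rangeRestrict_bijective_of_injective
      (SubMixedHodgeStructure.inclusion_injective hS))

/-- **The semisimple sub-MHS are exactly the sub-MHS of the socle.** [cite: CattaniElZeinGriffithsLe2014, Thm. 3.2.18 and p. 270] -/
theorem isSemisimple_iff_le_socle [FiniteDimensional ℚ V] (S : SubMixedHodgeStructure H) :
    S.toMixedHodgeStructure.IsSemisimple ↔ S.toSubmodule ≤ (socle H).toSubmodule :=
  ⟨le_socle S, isSemisimple_of_le_socle S⟩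

end Socle

end MixedHodgeStructure

end Literature.AlgebraicGeometry.Motives
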